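import Summits.AtomisticToContinuum.BoseEinsteinCondensation.Theorems.BECInfDivCoherenceLevyMassCondensationFourier
import HarnessLib

/-!
# Route `BECInfDivCoherence`, crux `GridInfDivCoherence` (stmt-AtomisticToContinuum-9114) —
# support lemma: cosine Fourier inversion on `(ℤ/m)³` for even grid functions

`stub_cosInversionEven`: for `m : ℕ` with `[NeZero m]` and an EVEN real grid function `F` on the
finite torus `(ℤ/m)³ = (Fin 3 → Fin m)` (`F (-j) = F j`), the discrete Lévy weights
`ν_q = m⁻³ Σ_{j'} F(j') cos(2π q·j'/m)` reconstruct `F`: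
`F(j) = Σ_q ν_q cos(2π q·j/m)` for every `j`.

This is the pure stub of the same name in the birth skeleton of the crux (converse chain
`GridInfDivCoherence → stub_hadamardPowerCoherence`): the lead writes `F = log G ∘ nodes` as a cosine
combination of its Lévy weights.

Proof: swap the two finite sums; by product-to-sum (`Real.cos_add`, `Real.cos_sub` on the integer
vectors `j' + j`, `j' - j`) and the roots-of-unity sum `InfDivGlue.sum_cos_grid`
(`BECInfDivCoherenceLevyMassCondensationFourier.lean`), the character sum
`Σ_q cos(2π q·j'/m) cos(2π q·j/m)` equals `(m³/2)([j' = -j] + [j' = j])`; hence the right-hand side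
is `(F(-j) + F(j))/2 = F(j)` by evenness (this also covers `m = 1`, where `-j = j`).

Folklore (Fourier inversion on a finite abelian group, e.g. Berg–Forst 1975, Ch. I). Deliberately
not here: anything about the coherence function itself, and the sign of the weights.
-/

noncomputable section

namespace Summit.AtomisticToContinuum.BoseEinsteinCondensation.Theorems

open Finset InfDivGlue

/-- **Cosine Fourier inversion on `(ℤ/m)³` for even grid functions.** For `[NeZero m]` and
`F : (Fin 3 → Fin m) → ℝ` with `F (-j) = F j`, every value is recovered from the discrete Lévy
weights `ν_q = m⁻³ Σ_{j'} F(j') cos(2π q·j'/m)`: `F(j) = Σ_q ν_q cos(2π q·j/m)`. The character sum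
`Σ_q cos(2π q·j'/m) cos(2π q·j/m) = (m³/2)([j' = -j] + [j' = j])` (product-to-sum and
`InfDivGlue.sum_cos_grid`), and evenness merges the two Kronecker deltas. [folklore] -/
theorem stub_cosInversionEven :
    ∀ (m : ℕ) [NeZero m] (F : (Fin 3 → Fin m) → ℝ), (∀ j, F (-j) = F j) →
      ∀ j : Fin 3 → Fin m, F j = ∑ q : Fin 3 → Fin m,
        (∑ j' : Fin 3 → Fin m, F j' *
            Real.cos (2 * Real.pi * (∑ k, ((q k : ℕ) : ℝ) * ((j' k : ℕ) : ℝ)) / m)) / (m : ℝ) ^ 3 *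
          Real.cos (2 * Real.pi * (∑ k, ((q k : ℕ) : ℝ) * ((j k : ℕ) : ℝ)) / m) := by
  intro m _ F hev j
  have hm0 : (m : ℝ) ^ 3 ≠ 0 := pow_ne_zero _ (Nat.cast_ne_zero.2 (NeZero.ne m))
  -- the integer vectors `j' + j` and `j' - j`
  set np : (Fin 3 → Fin m) → Fin 3 → ℤ := fun j' k =>
    ((j' k : ℕ) : ℤ) + ((j k : ℕ) : ℤ) with hnp
  set nm : (Fin 3 → Fin m) → Fin 3 → ℤ := fun j' k =>
    ((j' k : ℕ) : ℤ) - ((j k : ℕ) : ℤ) with hnm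
  -- product-to-sum
  have hps : ∀ q j' : Fin 3 → Fin m,
      Real.cos (2 * Real.pi * (∑ k, ((q k : ℕ) : ℝ) * ((j' k : ℕ) : ℝ)) / m) *
        Real.cos (2 * Real.pi * (∑ k, ((q k : ℕ) : ℝ) * ((j k : ℕ) : ℝ)) / m) =
      (Real.cos (2 * Real.pi * (∑ k, ((q k : ℕ) : ℝ) * (np j' k : ℝ)) / m) +
        Real.cos (2 * Real.pi * (∑ k, ((q k : ℕ) : ℝ) * (nm j' k : ℝ)) / m)) / 2 := by
    intro q j'
    have hsum1 : ∑ k, ((q k : ℕ) : ℝ) * (np j' k : ℝ) =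
        ∑ k, ((q k : ℕ) : ℝ) * ((j' k : ℕ) : ℝ) + ∑ k, ((q k : ℕ) : ℝ) * ((j k : ℕ) : ℝ) := by
      simp only [hnp, Int.cast_add, Int.cast_natCast, mul_add, Finset.sum_add_distrib]
    have hsum2 : ∑ k, ((q k : ℕ) : ℝ) * (nm j' k : ℝ) =
        ∑ k, ((q k : ℕ) : ℝ) * ((j' k : ℕ) : ℝ) - ∑ k, ((q k : ℕ) : ℝ) * ((j k : ℕ) : ℝ) := by
      simp only [hnm, Int.cast_sub, Int.cast_natCast, mul_sub, Finset.sum_sub_distrib]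
    rw [hsum1, hsum2]
    set S : ℝ := ∑ k, ((q k : ℕ) : ℝ) * ((j' k : ℕ) : ℝ) with hS
    set T : ℝ := ∑ k, ((q k : ℕ) : ℝ) * ((j k : ℕ) : ℝ) with hT
    have e1 : 2 * Real.pi * (S + T) / m = 2 * Real.pi * S / m + 2 * Real.pi * T / m := by ring
    have e2 : 2 * Real.pi * (S - T) / m = 2 * Real.pi * S / m - 2 * Real.pi * T / m := by ring
    rw [e1, e2, Real.cos_add, Real.cos_sub]
    ring
  have hps' : ∀ q j' : Fin 3 → Fin m,
      F j' * Real.cos (2 * Real.pi * (∑ k, ((q k : ℕ) : ℝ) * ((j' k : ℕ) : ℝ)) / m) *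
        Real.cos (2 * Real.pi * (∑ k, ((q k : ℕ) : ℝ) * ((j k : ℕ) : ℝ)) / m) =
      F j' * ((Real.cos (2 * Real.pi * (∑ k, ((q k : ℕ) : ℝ) * (np j' k : ℝ)) / m) +
        Real.cos (2 * Real.pi * (∑ k, ((q k : ℕ) : ℝ) * (nm j' k : ℝ)) / m)) / 2) := by
    intro q j'
    rw [mul_assoc, hps]
  -- divisibility on the grid: `m ∣ j' + j ↔ j' = -j` and `m ∣ j' - j ↔ j' = j`
  have hdvd_add : ∀ j' : Fin 3 → Fin m, (∀ k, (m : ℤ) ∣ np j' k) ↔ j' = -j := by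
    intro j'
    rw [funext_iff]
    refine forall_congr' fun k => ?_
    rw [Pi.neg_apply, eq_neg_iff_add_eq_zero, Fin.ext_iff, Fin.val_add, Fin.val_zero,
      ← Nat.dvd_iff_mod_eq_zero]
    simp only [hnp]
    exact_mod_cast Int.natCast_dvd_natCast
  have hdvd_sub : ∀ j' : Fin 3 → Fin m, (∀ k, (m : ℤ) ∣ nm j' k) ↔ j' = j := by
    intro j'
    constructor
    · intro hd
      funext k
      have hk := hd k
      simp only [hnm] at hk
      have hlt1 : ((j' k : ℕ) : ℤ) < m := by exact_mod_cast (j' k).isLt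
      have hlt2 : ((j k : ℕ) : ℤ) < m := by exact_mod_cast (j k).isLt
      have hnn1 : (0 : ℤ) ≤ ((j' k : ℕ) : ℤ) := by positivity
      have hnn2 : (0 : ℤ) ≤ ((j k : ℕ) : ℤ) := by positivity
      have habs : |((j' k : ℕ) : ℤ) - ((j k : ℕ) : ℤ)| < m := by
        rw [abs_lt]; constructor <;> linarith
      have h0 := Int.eq_zero_of_abs_lt_dvd hk habs
      apply Fin.ext
      omega
    · rintro rfl k
      simp [hnm]
  symm
  calc ∑ q : Fin 3 → Fin m, (∑ j' : Fin 3 → Fin m, F j' *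
        Real.cos (2 * Real.pi * (∑ k, ((q k : ℕ) : ℝ) * ((j' k : ℕ) : ℝ)) / m)) / (m : ℝ) ^ 3 *
        Real.cos (2 * Real.pi * (∑ k, ((q k : ℕ) : ℝ) * ((j k : ℕ) : ℝ)) / m)
      = (∑ j' : Fin 3 → Fin m, F j' * ∑ q : Fin 3 → Fin m,
          (Real.cos (2 * Real.pi * (∑ k, ((q k : ℕ) : ℝ) * (np j' k : ℝ)) / m) +
            Real.cos (2 * Real.pi * (∑ k, ((q k : ℕ) : ℝ) * (nm j' k : ℝ)) / m)) / 2) /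
          (m : ℝ) ^ 3 := by
        simp_rw [div_mul_eq_mul_div, Finset.sum_mul, hps']
        rw [← Finset.sum_div, Finset.sum_comm]
        simp_rw [← Finset.mul_sum]
    _ = (∑ j' : Fin 3 → Fin m, F j' *
          (((if j' = -j then (m : ℝ) ^ 3 else 0) +
            (if j' = j then (m : ℝ) ^ 3 else 0)) / 2)) / (m : ℝ) ^ 3 := by
        congr 1
        refine Finset.sum_congr rfl fun j' _ => ?_
        congr 1
        rw [← Finset.sum_div, Finset.sum_add_distrib, sum_cos_grid, sum_cos_grid]
        congr 3
        · exact propext (hdvd_add j')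
        · exact propext (hdvd_sub j')
    _ = (F (-j) + F j) / 2 := by
        have hsum : ∀ α : Fin 3 → Fin m,
            ∑ j' : Fin 3 → Fin m, F j' * (if j' = α then (m : ℝ) ^ 3 else 0) =
              F α * (m : ℝ) ^ 3 := by
          intro α
          simp_rw [mul_ite, mul_zero]
          rw [Finset.sum_ite_eq']
          simp
        have hre : ∑ j' : Fin 3 → Fin m, F j' *
            (((if j' = -j then (m : ℝ) ^ 3 else 0) +
              (if j' = j then (m : ℝ) ^ 3 else 0)) / 2) =
            (∑ j' : Fin 3 → Fin m, F j' * (if j' = -j then (m : ℝ) ^ 3 else 0) +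
              ∑ j' : Fin 3 → Fin m, F j' * (if j' = j then (m : ℝ) ^ 3 else 0)) / 2 := by
          rw [← Finset.sum_add_distrib, Finset.sum_div]
          exact Finset.sum_congr rfl fun j' _ => by ring
        rw [hre, hsum, hsum, ← add_mul, div_div, mul_div_mul_right _ _ hm0]
    _ = F j := by rw [hev j]; ring
end Summit.AtomisticToContinuum.BoseEinsteinCondensation.Theorems

end
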